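import Literature.AlgebraicGeometry.ComplexMultiplication.CyclotomicFermatCMTypesOddTwoPrimeLevelTheoremTwo
import HarnessLib

/-!
# Koblitz–Rohrlich, THEOREM 2 IN FULL — relatively prime AND boundary triples, BOTH families — at `N = 25` and `N = 35`: the stabilisers
# `W_{1,a,−1−a}` for every `a` (kernel computations), simplicity of the abelian varieties of type `Φ_{(1,a,−1−a)}`

Layer `Literature/AlgebraicGeometry/ComplexMultiplication`, namespace `…ComplexMultiplication.CyclotomicFermatCMType`; sequel of
`CyclotomicFermatCMTypesOddTwoPrimeLevelTheoremTwo` (the bridges `wH = H ⟺ H_{wτ} = H_τ` and "a stabilising unit gives a coincidence")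
and `CyclotomicFermatCMTypesTheoremTwoFamilies` (the converse for both families at every level).  THEOREMS ONLY (no definition, no named
fact, no `sorry`).

THE SOURCE.  N. Koblitz, D. Rohrlich, *Simple factors in the Jacobian of a Fermat curve*, Canad. J. Math. **30** (1978) 1183–1205,
pp. 1185–1186: "If at least one of `rM/N, sM/N, tM/N` is prime to `M` … then one deduces that for `w ≠ 1`, either `1 + w + w² = 0` in `ℤ/Mℤ`
or `w² = 1` in `ℤ/Mℤ`. … THEOREM 2. Suppose `N` is prime to `6`. The only lattices `L_{r,s,t}` which are not simple are those for which
`{r, s, t}` is equivalent to a triple of the form `{N/M, ⟨wN/M⟩, ⟨w²N/M⟩}`, for some divisor `M` of `N`, and some `w ∈ ℤ/Mℤ` such that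
`1 + w + w² = 0`, or to a triple of the form `{N/M, ⟨wN/M⟩, ⟨−(1+w)N/M⟩}`, for some divisor `M` of `N`, and some `w ∈ ℤ/Mℤ` such that
`w² = 1`, `w ≠ ±1`. In particular, if `N` equals a prime `p`, then all the factors `L_{r,s,t}` are simple if `p ≡ 2 mod 3`"; §1 (p. 1184):
"`L_{r,s}` is simple if and only if `W_{r,s} = {1}`".

WHAT IS PROVED (`M = N`, triples normalised to `(1, a, −1−a)` with `a, −1−a` non-zero — every triple with a unit entry is equivalent to
one; NO unit hypothesis on `a`, `1 + a`: the boundary triples are included).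

* §1 `N = 25`: for EVERY such `a` the stabiliser is trivial — `H_{w,wa,w(−1−a)} = H_{1,a,−1−a}` iff `w = 1` (kernel computation over all
  `(a, w)`, `fermatCMType_mul_eq_iff_twentyFive`), so `W_{1,a,−1−a} = {1}` (`hasTrivialStabilizer_fermat_one_twentyFive`) and **every abelian
  variety of type `(ℚ(ζ₂₅); Φ_{(1,a,−1−a)})` is SIMPLE** (`isSimple_of_fermat_one_twentyFive`; neither family occurs at `25`: `1 + w + w² = 0`
  and `w² = 1, w ≠ ±1` have no solutions — "all the factors are simple if `p ≡ 2 mod 3`", here at `p² = 25`).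
* §2 `N = 35`: the stabilisers for every `a` (`fermatCMType_mul_eq_iff_thirtyFive`): `W = {1}` unless `{1, a, −1−a}` is K–R's SECOND family
  `{1, w, −1−w}`, `w² = 1`, `w ≠ ±1` (`w = 6, 29`: the triples `(1,6,28)`, `(1,29,5)` and their rearrangements `a ∈ {5, 6, 28, 29}`), where
  `W = {1, w}` has order `2`; the first family is empty at `35`.  Hence **THEOREM 2 IN FULL at `35`**: `W_{1,a,−1−a} = {1}` ⟺ `Φ` primitive ⟺
  its abelian varieties simple ⟺ NOT [`1 + a + a² = 0 ∧ a ≠ 1`] ∧ NOT [`a² = 1 ∧ a ≠ ±1`] ∧ NOT [`(1+a)² = 1 ∧ a ∉ {0, −2}`]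
  (`hasTrivialStabilizer_fermat_one_iff_thirtyFive`, `isPrimitive_fermat_one_iff_thirtyFive`, `isSimple_of_fermat_one_iff_thirtyFive`).

## Honest column / NOT here

* Theorem 2 for general `N` prime to `6` in the boundary case is NOT typed (its "only" direction rests on the §3 Proposition); `25`, `35` only,
  and only `M = N` (triples through `1`; the factors of lower level `M < N` are the siblings' business at level `M`).
* The factor count `|W|` (`= 2` on the second family at `35`: "isogenous to a product of `|W|` isomorphic simple factors") is typed only as the
  order of the stabiliser, not as an isogeny decomposition.
* Kernel `decide` only; private: `isUnit_iff_val_coprime₁₃`, the generic bridge `hasTrivialStabilizer_iff_of_table`.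

## References

* [KoblitzRohrlich1978] N. Koblitz, D. Rohrlich, Canad. J. Math. 30 (1978) 1183–1205: Theorem 2 and its proof (pp. 1185–1186), §1 (p. 1184),
  §3 (p. 1193).
* [Shimura1998] G. Shimura, *Abelian Varieties with Complex Multiplication and Modular Functions*, §8.2 Prop. 26 (through the siblings).

## Provenance

Cell `pub-hodgecm2` (COR-CM), literature seat `lit-deligne-3` gen 35 (claim KR78-THM2-BOUNDARY; count-neutral, own lane).
-/

noncomputable section

open NumberField

namespace Literature.AlgebraicGeometry.ComplexMultiplication

open Literature.NumberTheory.ComplexMultiplication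
open Literature.AlgebraicGeometry.HodgeTheory
open Literature.AlgebraicGeometry.Pohlmann1968 Literature.AlgebraicGeometry.Pohlmann1968.Cyclotomic
open CyclotomicCMTypeResidueSets (IsCMResidueSet HasTrivialStabilizer unitResidues)

namespace CyclotomicFermatCMType

/-! ## §0 Any level: from a stabiliser table to `W = {1} ⟺ ¬(exceptional)` -/

section Bridge

variable {N : ℕ} [NeZero N]

/-- Units of `ℤ/N` are the residues with value prime to `N` (private copy of the siblings'). [folklore] -/
private theorem isUnit_iff_val_coprime₁₃ (x : ZMod N) : IsUnit x ↔ x.val.Coprime N := by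
  conv_lhs => rw [← ZMod.natCast_zmod_val x]
  exact ZMod.isUnit_iff_coprime x.val N

/-- The generic bridge: if a table says, for all units `w`, that `H_{w,wa,w(−1−a)} = H_{1,a,−1−a}` iff `w = 1 ∨ E w` (with `E w → w ≠ 1`),
then `W_{1,a,−1−a} = {1}` iff no unit `w` satisfies `E w`. [cite: KoblitzRohrlich1978, §1 (p. 1184) and proof of Theorem 2 (p. 1185)] -/
private theorem hasTrivialStabilizer_iff_of_table {a : ZMod N} {E : ZMod N → Prop}
    (table : ∀ w : ZMod N, IsUnit w → (fermatCMType N w (w * a) (w * (-1 - a)) = fermatCMType N 1 a (-1 - a) ↔ (w = 1 ∨ E w)))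
    (hE : ∀ w, E w → w ≠ 1) :
    HasTrivialStabilizer N (fermatCMType N 1 a (-1 - a)) ↔ ¬∃ w : ZMod N, IsUnit w ∧ E w := by
  constructor
  · rintro hW ⟨w, hw, hEw⟩
    have heq : fermatCMType N w (w * a) (w * (-1 - a)) = fermatCMType N 1 a (-1 - a) := (table w hw).2 (Or.inr hEw)
    have h1 : fermatCMType N (w * 1) (w * a) (w * (-1 - a)) = fermatCMType N 1 a (-1 - a) := by rw [mul_one]; exact heq
    have hall := (forall_mem_iff_mul_mem_iff_fermatCMType_mul_eq hw).2 h1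
    refine hE w hEw (hW w ((mem_unitResidues_iff_isUnit w).2 hw) fun c _ => ?_)
    rw [mul_comm]
    exact (hall c).symm
  · intro H t ht hstab
    have htu : IsUnit t := (mem_unitResidues_iff_isUnit t).1 ht
    rcases (table t htu).1 (fermatCMType_mul_eq_of_forall_mem_unitResidues htu hstab) with h1 | hEt
    · exact h1
    · exact absurd ⟨t, htu, hEt⟩ H

end Bridge

/-! ## §1 `N = 25`: every stabiliser is trivial — all abelian varieties of the types `Φ_{(1,a,−1−a)}` are simple -/

section TwentyFive

/-- **The stabiliser table at `N = 25`** (kernel computation over all `a, w` with `a, −1−a ≠ 0`, `w` a unit; boundary `a` included): `H_{w,wa,w(−1−a)} =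
H_{1,a,−1−a}` iff `w = 1`. [cite: KoblitzRohrlich1978, Theorem 2 (pp. 1185–1186)] -/
theorem fermatCMType_mul_eq_iff_twentyFive :
    ∀ a w : ZMod 25, a ≠ 0 → (-1 - a : ZMod 25) ≠ 0 → w.val.Coprime 25 →
      (fermatCMType 25 w (w * a) (w * (-1 - a)) = fermatCMType 25 1 a (-1 - a) ↔ w = 1) := by
  decide

/-- **`W_{1,a,−1−a} = {1}` for EVERY `a` modulo `25`** (`a, −1−a ≠ 0`; no unit hypothesis on `a`, `1 + a`).
[cite: KoblitzRohrlich1978, Theorem 2 (pp. 1185–1186) and §1 (p. 1184)] -/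
theorem hasTrivialStabilizer_fermat_one_twentyFive {a : ZMod 25} (ha : a ≠ 0) (ha' : (-1 - a : ZMod 25) ≠ 0) :
    HasTrivialStabilizer 25 (fermatCMType 25 1 a (-1 - a)) := by
  have h := (hasTrivialStabilizer_iff_of_table (E := fun _ => False)
    (fun w hw => by
      rw [or_false]
      exact fermatCMType_mul_eq_iff_twentyFive a w ha ha' ((isUnit_iff_val_coprime₁₃ w).1 hw))
    (fun _ h => h.elim)).2
  exact h fun ⟨_, _, hF⟩ => hF

open CategoryTheory
open Literature.AlgebraicGeometry.Motives (AbelianVariety)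

variable {L : Type} [Field L] [NumberField L] [IsCyclotomicExtension {25} ℚ L]
  {A : AbelianVariety ℂ} {ι : 𝓞 L →+* End A} {θ : L →+* Module.End ℂ (complexBetti A.X 1)}

/-- **THEOREM 2 IN FULL at `N = 25`: every abelian variety of type `(ℚ(ζ₂₅); Φ_{(1,a,−1−a)})`, `a, −1−a ≠ 0` — unit OR boundary triple — is
SIMPLE** (neither exceptional family occurs modulo `25`; "all the factors `L_{r,s,t}` are simple if `p ≡ 2 mod 3`", here at `p² = 25`).
[cite: KoblitzRohrlich1978, Theorem 2 (pp. 1185–1186)] [cite: Shimura1998, §8.2 Prop. 26] -/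
theorem isSimple_of_fermat_one_twentyFive {a : ZMod 25} (ha : a ≠ 0) (ha' : (-1 - a : ZMod 25) ≠ 0)
    {hS : ∀ c : ZMod 25, c.val.Coprime 25 → (c ∈ fermatCMType 25 1 a (-1 - a) ↔ -c ∉ fermatCMType 25 1 a (-1 - a))}
    (hA : IsCMTypeRealisation (cmTypeOfResidues (L := L) (fermatCMType 25 1 a (-1 - a)) hS) A ι θ) : A.IsSimple := by
  obtain ⟨φ₀⟩ : Nonempty (L →+* ℂ) := inferInstance
  rw [isSimple_iff_isPrimitive hA φ₀, CyclotomicCMTypeResidueSets.isPrimitive_iff_hasTrivialStabilizer 25,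
    CyclotomicCMTypeResidueSets.residueSet_cmTypeOfResidues 25 (isCMResidueSet_fermatCMType hS)]
  exact hasTrivialStabilizer_fermat_one_twentyFive ha ha'

end TwentyFive

/-! ## §2 `N = 35`: the second family `{1, w, −1−w}`, `w = ±6`, is the only exception -/

section ThirtyFive

/-- **The stabiliser table at `N = 35`** (kernel computation over all `a, w` with `a, −1−a ≠ 0`, `w` a unit): `H_{w,wa,w(−1−a)} = H_{1,a,−1−a}`
iff `w = 1`, or `a² = 1`, `a ≠ ±1` and `w = a`, or `(1 + a)² = 1`, `a ∉ {0, −2}` and `w = −1−a` — i.e. `W = {1, w}` on the second family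
`{1, w, −1−w}` (`w² = 1`, `w ≠ ±1`: `w ∈ {6, 29}`) and `W = {1}` otherwise (the first family `1 + w + w² = 0` is empty modulo `35`).
[cite: KoblitzRohrlich1978, Theorem 2 and its proof (pp. 1185–1186)] -/
theorem fermatCMType_mul_eq_iff_thirtyFive :
    ∀ a w : ZMod 35, a ≠ 0 → (-1 - a : ZMod 35) ≠ 0 → w.val.Coprime 35 →
      (fermatCMType 35 w (w * a) (w * (-1 - a)) = fermatCMType 35 1 a (-1 - a) ↔
        (w = 1 ∨ ((a ^ 2 = 1 ∧ a ≠ 1 ∧ a ≠ -1 ∧ w = a) ∨ ((1 + a) ^ 2 = 1 ∧ a ≠ 0 ∧ a ≠ -2 ∧ w = -1 - a)))) := by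
  decide

/-- The two families modulo `35`: `1 + a + a² = 0` has NO solution, and `a² = 1, a ≠ ±1` iff `a ∈ {6, 29}` (kernel computation).
[cite: KoblitzRohrlich1978, Theorem 2 (pp. 1185–1186)] -/
theorem families_thirtyFive :
    (∀ a : ZMod 35, 1 + a + a ^ 2 ≠ 0) ∧ ∀ a : ZMod 35, (a ^ 2 = 1 ∧ a ≠ 1 ∧ a ≠ -1) ↔ (a = 6 ∨ a = 29) := by
  decide

/-- **THEOREM 2's stabiliser dichotomy IN FULL at `N = 35`**: for `a, −1−a ≠ 0` (unit or boundary), `W_{1,a,−1−a} = {1}` iff `{1, a, −1−a}` is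
not of the second family, i.e. NOT (`a² = 1 ∧ a ≠ ±1`) and NOT (`(1+a)² = 1 ∧ a ∉ {0, −2}`) (the first family being empty at `35`).
[cite: KoblitzRohrlich1978, Theorem 2 (pp. 1185–1186) and §1 (p. 1184)] -/
theorem hasTrivialStabilizer_fermat_one_iff_thirtyFive {a : ZMod 35} (ha : a ≠ 0) (ha' : (-1 - a : ZMod 35) ≠ 0) :
    HasTrivialStabilizer 35 (fermatCMType 35 1 a (-1 - a)) ↔
      ¬(a ^ 2 = 1 ∧ a ≠ 1 ∧ a ≠ -1) ∧ ¬((1 + a) ^ 2 = 1 ∧ a ≠ 0 ∧ a ≠ -2) := by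
  rw [hasTrivialStabilizer_iff_of_table
    (E := fun w => (a ^ 2 = 1 ∧ a ≠ 1 ∧ a ≠ -1 ∧ w = a) ∨ ((1 + a) ^ 2 = 1 ∧ a ≠ 0 ∧ a ≠ -2 ∧ w = -1 - a))
    (fun w hw => fermatCMType_mul_eq_iff_thirtyFive a w ha ha' ((isUnit_iff_val_coprime₁₃ w).1 hw))
    (by
      rintro w (⟨_, h1, _, rfl⟩ | ⟨_, _, h2, rfl⟩)
      · exact h1
      · intro h
        exact h2 (by linear_combination (-1 : ZMod 35) * h))]
  constructor
  · intro H
    refine ⟨fun h => H ⟨a, ?_, Or.inl ⟨h.1, h.2.1, h.2.2, rfl⟩⟩, fun h => H ⟨-1 - a, ?_, Or.inr ⟨h.1, h.2.1, h.2.2, rfl⟩⟩⟩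
    · exact IsUnit.of_mul_eq_one a (by linear_combination h.1)
    · exact IsUnit.of_mul_eq_one (-1 - a) (by linear_combination h.1)
  · rintro ⟨H1, H2⟩ ⟨w, -, (⟨h1, h2, h3, -⟩ | ⟨h1, h2, h3, -⟩)⟩
    · exact H1 ⟨h1, h2, h3⟩
    · exact H2 ⟨h1, h2, h3⟩

open CategoryTheory
open Literature.AlgebraicGeometry.Motives (AbelianVariety)

variable {L : Type} [Field L] [NumberField L] [IsCyclotomicExtension {35} ℚ L]
  {A : AbelianVariety ℂ} {ι : 𝓞 L →+* End A} {θ : L →+* Module.End ℂ (complexBetti A.X 1)}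

/-- **THEOREM 2 on CM types IN FULL at `N = 35`**: `Φ_{(1,a,−1−a)}` of `ℚ(ζ₃₅)` (`a, −1−a ≠ 0`, unit or boundary) is primitive iff
`{1, a, −1−a}` is not `{1, w, −1−w}` with `w² = 1`, `w ≠ ±1`. [cite: KoblitzRohrlich1978, Theorem 2 (pp. 1185–1186)] [cite: Shimura1998, §8.2 Prop. 26] -/
theorem isPrimitive_fermat_one_iff_thirtyFive {a : ZMod 35} (ha : a ≠ 0) (ha' : (-1 - a : ZMod 35) ≠ 0)
    {hS : ∀ c : ZMod 35, c.val.Coprime 35 → (c ∈ fermatCMType 35 1 a (-1 - a) ↔ -c ∉ fermatCMType 35 1 a (-1 - a))}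
    (φ₀ : L →+* ℂ) :
    IsPrimitive (ℂ ≃+* ℂ) (cmTypeOfResidues (L := L) (fermatCMType 35 1 a (-1 - a)) hS).1 φ₀ ↔
      ¬(a ^ 2 = 1 ∧ a ≠ 1 ∧ a ≠ -1) ∧ ¬((1 + a) ^ 2 = 1 ∧ a ≠ 0 ∧ a ≠ -2) := by
  rw [CyclotomicCMTypeResidueSets.isPrimitive_iff_hasTrivialStabilizer 35,
    CyclotomicCMTypeResidueSets.residueSet_cmTypeOfResidues 35 (isCMResidueSet_fermatCMType hS)]
  exact hasTrivialStabilizer_fermat_one_iff_thirtyFive ha ha'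

/-- **THEOREM 2 on abelian varieties IN FULL at `N = 35`**: an abelian variety of type `(ℚ(ζ₃₅); Φ_{(1,a,−1−a)})` (`a, −1−a ≠ 0`, unit or
boundary) is SIMPLE iff `{1, a, −1−a}` is not of the second family (`a ∉ {5, 6, 28, 29}`): the non-simple types are exactly those of
`(1, 6, 28)` and `(1, 29, 5)` (the sibling's `exists_not_isSimple_thirtyFive`).
[cite: KoblitzRohrlich1978, Theorem 2 (pp. 1185–1186)] [cite: Shimura1998, §8.2 Prop. 26] -/
theorem isSimple_of_fermat_one_iff_thirtyFive {a : ZMod 35} (ha : a ≠ 0) (ha' : (-1 - a : ZMod 35) ≠ 0)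
    {hS : ∀ c : ZMod 35, c.val.Coprime 35 → (c ∈ fermatCMType 35 1 a (-1 - a) ↔ -c ∉ fermatCMType 35 1 a (-1 - a))}
    (hA : IsCMTypeRealisation (cmTypeOfResidues (L := L) (fermatCMType 35 1 a (-1 - a)) hS) A ι θ) :
    A.IsSimple ↔ ¬(a ^ 2 = 1 ∧ a ≠ 1 ∧ a ≠ -1) ∧ ¬((1 + a) ^ 2 = 1 ∧ a ≠ 0 ∧ a ≠ -2) := by
  obtain ⟨φ₀⟩ : Nonempty (L →+* ℂ) := inferInstance
  rw [isSimple_iff_isPrimitive hA φ₀, isPrimitive_fermat_one_iff_thirtyFive ha ha' φ₀]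

/-- The exceptional residues at `35` spelled out: the condition of `isSimple_of_fermat_one_iff_thirtyFive` fails iff `a ∈ {5, 6, 28, 29}`
(kernel computation). [cite: KoblitzRohrlich1978, Theorem 2 (pp. 1185–1186)] -/
theorem not_simple_condition_iff_thirtyFive :
    ∀ a : ZMod 35, ¬(¬(a ^ 2 = 1 ∧ a ≠ 1 ∧ a ≠ -1) ∧ ¬((1 + a) ^ 2 = 1 ∧ a ≠ 0 ∧ a ≠ -2)) ↔
      (a = 5 ∨ a = 6 ∨ a = 28 ∨ a = 29) := by
  decide

end ThirtyFive

end CyclotomicFermatCMType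

end Literature.AlgebraicGeometry.ComplexMultiplication
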